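import Mathlib
import HarnessLib
import Literature.Analysis.FluidPDE.EnergyToolkit
import Literature.Analysis.FluidPDE.VorticityEquation

/-!
# Stub `stub_newcombClosedLine` of the line `Ideator2Sketch` (card `flux-surface-persistence`)
# (crux `IsobaricLinesLiouville`, stmt-NavierStokesRegularity-11741, route `IsobarTomography`)

**Newcomb's solvability integral on closed vortex lines.** Let `(v, q)` be a classical
Navier–Stokes solution (`ν = 1`, `f = 0`) on `(-∞, 0) × ℝ³`, `ω(t) = curl (v t)` its vorticity and
`Dₜq(t, ·) = y ↦ ∂ₜq(t, y) + ⟪v(t, y), ∇q(t, y)⟫` the material derivative of the pressure (the time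
derivative being the one-sided one within `(-∞, 0)`, `Fluid.timeDerivWithin`). Suppose the
*persistence identity* (first prolongation of the isobaricity of vortex lines)
`⟪ω, ∇(Dₜq)⟫ = -⟪Δω, ∇q⟫` holds at every `t < 0` and every point. Then on every CLOSED vortex line
`γ` of a slice `t < 0` — an integral curve of `ω(t)`, `γ' = ω(t) ∘ γ`, with a period `T > 0` — the
"resistive slip" `⟪Δω, ∇q⟫` integrates to zero over one period:
`∫₀ᵀ ⟪Δω(γ s), ∇q(γ s)⟫ ds = 0`.
This is Newcomb's necessary condition (1959) for the solvability of the magnetic differential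
equation `ω·∇f = g` on a closed field line, here read off trivially: by the chain rule the
integrand is `-d/ds (Dₜq)(γ s)`, and the fundamental theorem of calculus over one period gives
`-[(Dₜq)(γ T) − (Dₜq)(γ 0)] = 0` because `γ T = γ 0`.

What is supplied here (all folklore calculus): the slice `Dₜq(t, ·)` is `C^∞` (the within-time
derivative of the jointly smooth pressure is jointly smooth, `IsSmoothSpaceTimeOn.timeDerivWithin`;
`IsSmoothSpaceTimeOn.gradient`, `ContDiff.inner`), so `D(Dₜq)(y) w = ⟪∇(Dₜq)(y), w⟫` and the chain
rule `HasFDerivAt.comp_hasDerivAt` applies along `γ`; the integrand is continuous (the slice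
vorticity is jointly smooth as `curlCLM ∘ D(v ·)`, hence so is its Laplacian,
`IsSmoothSpaceTimeOn.laplacian`), which feeds `intervalIntegral.integral_eq_sub_of_hasDerivAt`.

## References

* W. A. Newcomb, *Magnetic differential equations*, Phys. Fluids 2 (1959), 362–365 (the
  solvability condition `∮ g dl/B = 0` on closed field lines).
* H. Grad, J. Hogan, *Classical diffusion in a tokomak*, Phys. Rev. Lett. 24 (1970), 1337–1340.
-/

noncomputable section

-- the summit and its single problem share the name (D-0017 nested layout)
set_option linter.dupNamespace false

namespace Summit.NavierStokesRegularity.NavierStokesRegularity.Theorems.IsobaricLinesLiouville.FluxSurfacePersistence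

open scoped InnerProductSpace RealInnerProductSpace ContDiff Laplacian
open Literature.Analysis.FluidPDE Set Function

/-- **FTC on a closed curve.** If `F : ℝ → ℝ` has the continuous derivative `g` everywhere and
takes the same value at `0` and `T`, then `∫₀ᵀ g = 0`
(`intervalIntegral.integral_eq_sub_of_hasDerivAt`). [folklore] -/
theorem newcomb_integral_eq_zero_of_hasDerivAt_of_eq {F g : ℝ → ℝ} {T : ℝ}
    (hF : ∀ s, HasDerivAt F (g s) s) (hg : Continuous g) (hT : F T = F 0) :
    ∫ s in (0 : ℝ)..T, g s = 0 := by
  rw [intervalIntegral.integral_eq_sub_of_hasDerivAt (fun s _ => hF s) (hg.intervalIntegrable 0 T),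
    hT, sub_self]

/-- **Chain rule along a curve, gradient form.** For `f : ℝ³ → ℝ` differentiable and a curve `γ`
with velocity `γ' s = w`, `d/ds f(γ s) = ⟪w, ∇f(γ s)⟫` (`HasFDerivAt.comp_hasDerivAt` and
`Df(y) w = ⟪∇f(y), w⟫`, `InnerProductSpace.toDual_symm_apply`). [folklore] -/
theorem newcomb_hasDerivAt_comp_curve_inner_gradient {f : EuclideanSpace ℝ (Fin 3) → ℝ}
    (hf : Differentiable ℝ f) {γ : ℝ → EuclideanSpace ℝ (Fin 3)} {s : ℝ}
    {w : EuclideanSpace ℝ (Fin 3)} (hγ : HasDerivAt γ w s) :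
    HasDerivAt (fun r => f (γ r)) ⟪w, gradient f (γ s)⟫_ℝ s := by
  have h := ((hf (γ s)).hasFDerivAt).comp_hasDerivAt s hγ
  have he : fderiv ℝ f (γ s) w = ⟪w, gradient f (γ s)⟫_ℝ := by
    rw [real_inner_comm, gradient, InnerProductSpace.toDual_symm_apply]
  rw [← he]
  exact h

/-- **The slice material derivative of the pressure is smooth.** For a classical solution on
`(-∞, 0)` and `t < 0`, `y ↦ ∂ₜq(t, y) + ⟪v(t, y), ∇q(t, y)⟫` is `C^∞` (`∂ₜ` within `Iio 0`): the
within-time derivative of the jointly smooth pressure is jointly smooth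
(`IsSmoothSpaceTimeOn.timeDerivWithin`, `uniqueDiffOn_Iio`), hence has smooth slices, and so do
`v` and `∇q` (`IsSmoothSpaceTimeOn.gradient`). [folklore] -/
theorem newcomb_contDiff_materialDeriv_pressure_slice
    {v : ℝ → EuclideanSpace ℝ (Fin 3) → EuclideanSpace ℝ (Fin 3)}
    {q : ℝ → EuclideanSpace ℝ (Fin 3) → ℝ}
    (hcl : IsClassicalNSSolutionOn (Set.Iio 0) 1 0 v q) {t : ℝ} (ht : t < 0) :
    ContDiff ℝ ∞ (fun y => timeDerivWithin (Set.Iio 0) q t y + ⟪v t y, gradient (q t) y⟫_ℝ) := by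
  have htS : t ∈ Set.Iio (0 : ℝ) := ht
  have hS : UniqueDiffOn ℝ (Set.Iio (0 : ℝ)) := uniqueDiffOn_Iio 0
  have h1 : ContDiff ℝ ∞ (timeDerivWithin (Set.Iio 0) q t) :=
    (hcl.smooth_pressure.timeDerivWithin hS).contDiff_slice htS
  have h2 : ContDiff ℝ ∞ (v t) := hcl.contDiff_velocity htS
  have h3 : ContDiff ℝ ∞ (fun y => gradient (q t) y) :=
    (hcl.smooth_pressure.gradient hS).contDiff_slice htS
  exact h1.add (h2.inner ℝ h3)

/-- **The slice vorticity of a classical solution is jointly smooth** on `(-∞, 0) × ℝ³`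
(`curl = curlCLM ∘ D`, `IsSmoothSpaceTimeOn.fderiv_slice`, `IsSmoothSpaceTimeOn.clm_comp`).
[folklore] -/
theorem newcomb_isSmoothSpaceTimeOn_curl
    {v : ℝ → EuclideanSpace ℝ (Fin 3) → EuclideanSpace ℝ (Fin 3)}
    {q : ℝ → EuclideanSpace ℝ (Fin 3) → ℝ}
    (hcl : IsClassicalNSSolutionOn (Set.Iio 0) 1 0 v q) :
    IsSmoothSpaceTimeOn (Set.Iio 0) (fun s y => curl (v s) y) := by
  have hv : (fun s y => curl (v s) y) = fun s y => curlCLM (fderiv ℝ (v s) y) := by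
    funext s y
    rfl
  rw [hv]
  exact (hcl.smooth_velocity.fderiv_slice (uniqueDiffOn_Iio 0)).clm_comp curlCLM

/-- **The Laplacian of the slice vorticity is continuous** (indeed smooth: the slice at `t < 0`
of the jointly smooth field `Δω`, `IsSmoothSpaceTimeOn.laplacian`). [folklore] -/
theorem newcomb_continuous_laplacian_curl
    {v : ℝ → EuclideanSpace ℝ (Fin 3) → EuclideanSpace ℝ (Fin 3)}
    {q : ℝ → EuclideanSpace ℝ (Fin 3) → ℝ}
    (hcl : IsClassicalNSSolutionOn (Set.Iio 0) 1 0 v q) {t : ℝ} (ht : t < 0) :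
    Continuous (Δ (curl (v t))) := by
  have htS : t ∈ Set.Iio (0 : ℝ) := ht
  have h : ContDiff ℝ ∞ (fun y => (Δ (fun z => curl (v t) z)) y) :=
    ((newcomb_isSmoothSpaceTimeOn_curl hcl).laplacian (uniqueDiffOn_Iio 0)).contDiff_slice htS
  exact h.continuous

/-- **Newcomb solvability integral on closed vortex lines** (Newcomb 1959; Grad–Hogan 1970): if the
persistence identity `ω·∇(Dₜq) = -Δω·∇q` holds on the slices of a classical solution, then on every
closed vortex line `γ` of a slice `t < 0` (`γ' = ω(t) ∘ γ`, period `T > 0`) the resistive slip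
integrates to zero, `∫₀ᵀ Δω·∇q (γ s) ds = 0`. Proof: by the chain rule
(`newcomb_hasDerivAt_comp_curve_inner_gradient`) and the hypothesis, the integrand is
`-d/ds (Dₜq)(γ s)`;
the fundamental theorem of calculus over one period and `γ T = γ 0` (`Function.Periodic.eq`)
give zero. [folklore] -/
theorem stub_newcombClosedLine :
    ∀ (v : ℝ → (EuclideanSpace ℝ (Fin 3)) → (EuclideanSpace ℝ (Fin 3))) (q : ℝ → (EuclideanSpace ℝ (Fin 3)) → ℝ), IsClassicalNSSolutionOn (Set.Iio 0) 1 0 v q →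
      (∀ t < 0, ∀ x : (EuclideanSpace ℝ (Fin 3)),
        ⟪curl (v t) x,
            gradient (fun y => timeDerivWithin (Set.Iio 0) q t y + ⟪v t y, gradient (q t) y⟫_ℝ) x⟫_ℝ
          = - ⟪(Δ (curl (v t))) x, gradient (q t) x⟫_ℝ) →
      ∀ t < 0, ∀ (γ : ℝ → (EuclideanSpace ℝ (Fin 3))) (T : ℝ), 0 < T → (∀ s, HasDerivAt γ (curl (v t) (γ s)) s) →
        Function.Periodic γ T →
          ∫ s in (0 : ℝ)..T, ⟪(Δ (curl (v t))) (γ s), gradient (q t) (γ s)⟫_ℝ = 0 := by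
  intro v q hcl hP t ht γ T _hT hγ hper
  -- the slice material derivative of the pressure, `Dq = Dₜq(t, ·)`
  set Dq : EuclideanSpace ℝ (Fin 3) → ℝ :=
    fun y => timeDerivWithin (Set.Iio 0) q t y + ⟪v t y, gradient (q t) y⟫_ℝ
  have hDq_diff : Differentiable ℝ Dq :=
    (newcomb_contDiff_materialDeriv_pressure_slice hcl ht).differentiable (by simp)
  -- `s ↦ -Dq (γ s)` is a primitive of the integrand
  have hprim : ∀ s, HasDerivAt (fun r => -Dq (γ r))
      ⟪(Δ (curl (v t))) (γ s), gradient (q t) (γ s)⟫_ℝ s := by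
    intro s
    have h := (newcomb_hasDerivAt_comp_curve_inner_gradient hDq_diff (hγ s)).neg
    rw [hP t ht (γ s), neg_neg] at h
    exact h
  -- the integrand is continuous
  have hγc : Continuous γ := continuous_iff_continuousAt.2 fun s => (hγ s).continuousAt
  have hcont : Continuous fun s => ⟪(Δ (curl (v t))) (γ s), gradient (q t) (γ s)⟫_ℝ := by
    have hg : Continuous (fun y => gradient (q t) y) :=
      ((hcl.smooth_pressure.gradient (uniqueDiffOn_Iio 0)).contDiff_slice
        (show t ∈ Set.Iio (0 : ℝ) from ht)).continuous
    exact ((newcomb_continuous_laplacian_curl hcl ht).comp hγc).inner (hg.comp hγc)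
  -- one period: `γ T = γ 0`
  exact newcomb_integral_eq_zero_of_hasDerivAt_of_eq hprim hcont (by rw [hper.eq])

end Summit.NavierStokesRegularity.NavierStokesRegularity.Theorems.IsobaricLinesLiouville.FluxSurfacePersistence

end
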